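import Mathlib
import Summits.NavierStokesRegularity.NavierStokesRegularity.Theorems.ThreadingFluxHorizonTowerFiniteTowerIsolation
import Summits.NavierStokesRegularity.NavierStokesRegularity.Theorems.ThreadingFluxHorizonTowerZonalUniqueness
import HarnessLib

/-!
# Crux `PoloidalLiouville` (stmt-NavierStokesRegularity-1222), crux idea «horizon-threading-tower» (ns-idea-15):
# ★★ FINITE TOWERS AT ORDER ONE — A TOWER WITH A ZONAL TOP SHELL IS COAXIALLY ZONAL; COPRIME TOP DEGREES FORCE A ZONAL TOP SHELL

Support file (`--supports stmt-NavierStokesRegularity-1222`, helper; cell `ns-wall-extremal`, width hand ns-wall-eng-3 g4; 0 kit).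
The finite-shell case of the crux-idea conjecture `HorizonTower.HorizonTowerZonality` (Defs twin l.261), beyond two shells
(`twoShellHorizonTowerZonality`, p691920) and beyond the dipole towers `{1, m, n}` (ARM A).  For a finite scale-free tower
`U = Σ_{l∈K} U_{H_l}` of horizon profiles of smooth homogeneous harmonic shells (`K ⊂ ℕ` finite, degrees `≥ 1`, ANY number of shells)
annihilated by the order-one horizon law `𝔏₁` off the centre:

* ★★ `finiteTower_zonal_of_zonalTop` (THM A, ZONAL-TOP DESCENT): if the top shell `H_D` (`D = max K`, `H_D ≢ 0`) is infinitesimally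
  zonal about `a ≠ 0` (`⟪a × y, ∇H_D(y)⟫ ≡ 0`), then EVERY shell is zonal about `a` — the tower is axisymmetric without swirl;
* ★★ `finiteTower_zonal_of_coprime` (THM B, COPRIME TOP PAIR): if the two largest degrees `D′ < D` of `K` are coprime and
  `H_D, H_{D′} ≢ 0`, then the whole tower is zonal about one common axis (covers `{1,3,5}`, `{2,3,4}`, `{1,2,…,N}`, …);
* `…_zonalForm` versions with the zonal functional form `H_l(y) = ‖y‖^l g_l(⟪a,y⟫/‖y‖)` of the Defs twin.

PRECISIONS (ns-wall-crit-1 g5, 05:58:44Z): (P1) the descent is ordered by DECREASING DEGREE — at each step the largest not-yet-zonal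
degree `j₀ < D` is isolated against the zonal TOP shell (every competing pair with `j + k ≥ j₀ + D` consists of two coaxially zonal
shells); a class-by-class «top remaining pair» reading would be false (`K = {1,4,6,7}`: the even-class top pair is `(4,6)`).  With
`|K| = 2` and coprime degrees THM B re-derives (does NOT restate) `twoShellHorizonTowerZonality` BY NAME for those cells only; it does
NOT recover the non-coprime two-shell cells (e.g. `(2,4)`): the two-shell theorem spends the bracket on all of `ℝ³`, THM B only its
null-cone trace.

MECHANISM: the isolation lemma (`finiteTower_chartT_detP_eq_zero`) turns an isolated pair of shells into the weighted Wronskian law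
`j·f·g′ = k·g·f′` for the null-cone charts; one-variable root arithmetic (`…NullConeBinaryForms`) makes the charts powers of ONE
quadratic `q = chartT ⟪a,x⟫` (coprime exponents, or a zonal partner); a solid harmonic whose chart is `β q^l` is zonal about `a`
(`Zonal.detP_lin_eq_zero_of_chartT_eq`, via the injectivity of the chart on harmonics); the descent peels the shells from the top, the
largest non-zonal shell being isolated against the (zonal) top shell at every step.

HONEST LABEL: special cases (finite towers with a side condition) of the crux-IDEA conjecture `HorizonTowerZonality`; the general
finite tower (non-coprime top pair, top shell not known zonal), the general (infinite) tower, `PoloidalLiouville` (1222),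
`UnthreadedRigidity` (27585) and NS regularity remain OPEN; W1 movement 0.  [folklore]
-/

-- the summit and its single sub-problem share the name (CONVENTIONS §1)
set_option linter.dupNamespace false

noncomputable section

open MvPolynomial Complex
open scoped Polynomial RealInnerProductSpace
open Literature.Analysis.FluidPDE
open Literature.Geometry.DiscreteGeometry (inner_fin3 norm_sq_fin3)

namespace Summit.NavierStokesRegularity.NavierStokesRegularity.Theorems.PoloidalLiouville.HorizonTower

section FiniteTowerZonality

variable (K : Finset ℕ) (H : ℕ → E3 → ℝ)

/-! ### Zonal functional form ⇒ infinitesimal rotation invariance -/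

/-- The cross product with the zero vector vanishes. [folklore] -/
theorem cross_zero_right (a : E3) : cross a (0 : E3) = 0 := by
  obtain ⟨c0, c1, c2⟩ := cross_fin3 a (0 : E3)
  ext i
  fin_cases i
  · simp only [Fin.zero_eta, Fin.isValue, c0, PiLp.zero_apply, mul_zero, sub_self]
  · simp only [Fin.mk_one, Fin.isValue, c1, PiLp.zero_apply, mul_zero, sub_self]
  · simp only [Fin.reduceFinMk, Fin.isValue, c2, PiLp.zero_apply, mul_zero, sub_self]

/-- **Zonal functional form ⇒ infinitesimal zonality.**  If `G(y) = ‖y‖^l · g(⟪a, y⟫/‖y‖)` off the origin (`a ≠ 0`, ANY `g`) and `G`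
is differentiable, then `⟪a × y, ∇G(y)⟫ = 0` everywhere: `G` is constant along the rotation orbits about `a`, whose velocity is
`a × y` (no regularity of `g` is needed).  Converse of `exists_zonalForm_of_inner_cross_gradient_eq_zero`. [folklore] -/
theorem inner_cross_gradient_eq_zero_of_zonalForm {G : E3 → ℝ} {a : E3} {l : ℕ} (ha : a ≠ 0) (hG : Differentiable ℝ G)
    {g : ℝ → ℝ} (hzon : ∀ y : E3, y ≠ 0 → G y = ‖y‖ ^ l * g (⟪a, y⟫ / ‖y‖)) (y : E3) :
    ⟪cross a y, gradient G y⟫ = 0 := by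
  by_cases hy : y = 0
  · rw [hy, cross_zero_right, inner_zero_left]
  -- unit axis and the rotation path through `y`
  have hapos : 0 < ‖a‖ := norm_pos_iff.mpr ha
  set n : E3 := ‖a‖⁻¹ • a with hn
  have hn1 : ‖n‖ = 1 := by rw [hn, norm_smul, norm_inv, norm_norm, inv_mul_cancel₀ hapos.ne']
  have hnn : ⟪n, n⟫ = 1 := by rw [real_inner_self_eq_norm_sq, hn1, one_pow]
  set c : ℝ := ⟪n, y⟫ with hc
  set w : E3 := y - c • n with hw
  have hnw : ⟪n, w⟫ = 0 := by rw [hw, inner_sub_right, real_inner_smul_right, hnn, mul_one, hc, sub_self]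
  have hyw : c • n + w = y := by rw [hw]; abel
  set γ : ℝ → E3 := fun t => c • n + Real.cos t • w + Real.sin t • cross n w with hγ
  have hγ0 : γ 0 = y := by simp [hγ, hyw]
  -- the path stays on the sphere `‖·‖ = ‖y‖` and at height `⟪n, ·⟫ = c`
  have e1 : ⟪w, n⟫ = 0 := by rw [real_inner_comm]; exact hnw
  have e2 : ⟪n, cross n w⟫ = 0 := by rw [real_inner_comm]; exact Zonal.inner_cross_self_left n w
  have e3 : ⟪w, cross n w⟫ = 0 := by rw [real_inner_comm]; exact Zonal.inner_cross_self_right n w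
  have e4 : ⟪cross n w, cross n w⟫ = ‖w‖ ^ 2 := by
    rw [real_inner_self_eq_norm_sq, Zonal.norm_cross_sq, hn1, one_pow, one_mul, hnw]; ring
  have e5 : ⟪w, w⟫ = ‖w‖ ^ 2 := real_inner_self_eq_norm_sq w
  have hinner : ∀ t, ⟪n, γ t⟫ = c := by
    intro t
    simp only [hγ, inner_add_right, real_inner_smul_right, hnn, hnw, e2, mul_one, mul_zero, add_zero]
  have hsq : ∀ t, ‖γ t‖ ^ 2 = c ^ 2 + ‖w‖ ^ 2 := by
    intro t
    rw [← real_inner_self_eq_norm_sq]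
    simp only [hγ, inner_add_left, inner_add_right, real_inner_smul_left, real_inner_smul_right, hnn, hnw, e1, e2, e3,
      e4, e5, Zonal.inner_cross_self_left, Zonal.inner_cross_self_right]
    have hsc := Real.sin_sq_add_cos_sq t
    linear_combination ‖w‖ ^ 2 * hsc
  have hnorm : ∀ t, ‖γ t‖ = ‖y‖ := by
    intro t
    have h := (hsq t).trans (hsq 0).symm
    rw [hγ0] at h
    exact (sq_eq_sq₀ (norm_nonneg _) (norm_nonneg _)).mp h
  -- `G ∘ γ` is constant
  have hay : ∀ z : E3, ⟪a, z⟫ = ‖a‖ * ⟪n, z⟫ := by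
    intro z
    rw [hn, real_inner_smul_left, ← mul_assoc, mul_inv_cancel₀ hapos.ne', one_mul]
  have hconst : ∀ t, G (γ t) = G y := by
    intro t
    have hγt : γ t ≠ 0 := by
      intro h0; apply hy; rw [← norm_eq_zero, ← hnorm t, h0, norm_zero]
    rw [hzon (γ t) hγt, hzon y hy, hnorm t, hay, hay, hinner t, ← hγ0, hinner 0]
  -- differentiate at `t = 0`
  have hpath : HasDerivAt γ (cross n y) 0 := by
    have h := hasDerivAt_rotationPath hnn hnw c 0
    simp only [Real.cos_zero, Real.sin_zero, one_smul, zero_smul, add_zero] at h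
    rw [hyw] at h
    exact h
  have hGy : HasFDerivAt G (fderiv ℝ G y) (γ 0) := by rw [hγ0]; exact (hG y).hasFDerivAt
  have hd := hGy.comp_hasDerivAt (0 : ℝ) hpath
  have hzero : HasDerivAt (G ∘ γ) 0 0 := by
    have : G ∘ γ = fun _ => G y := funext fun t => hconst t
    rw [this]; exact hasDerivAt_const 0 (G y)
  have huniq := hd.unique hzero
  rw [← inner_gradient_eq_fderiv, real_inner_comm] at huniq
  -- scale back from `n` to `a`
  have hscale : cross a y = ‖a‖ • cross n y := by
    rw [hn, cross_smul_left, smul_smul, mul_inv_cancel₀ hapos.ne', one_smul]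
  rw [hscale, real_inner_smul_left, huniq, mul_zero]

/-! ### Polynomial-level lemmas -/

/-- The complexification of the linear form `⟪n, x⟫`. [folklore] -/
theorem map_lin (n : Fin 3 → ℝ) :
    map (algebraMap ℝ ℂ) (C (n 0) * X 0 + C (n 1) * X 1 + C (n 2) * X 2 : MvPolynomial (Fin 3) ℝ)
      = C (((n 0 : ℝ) : ℂ)) * X 0 + C (((n 1 : ℝ) : ℂ)) * X 1 + C (((n 2 : ℝ) : ℂ)) * X 2 := by
  simp [map_X]

/-- A real non-zero axis is a non-zero complex axis. [folklore] -/
theorem ofReal_axis_ne_zero {n : Fin 3 → ℝ} (hn : n ≠ 0) : (fun i => ((n i : ℝ) : ℂ)) ≠ 0 := by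
  intro h
  apply hn
  funext i
  have := congrFun h i
  simpa using this

/-- **Coaxial infinitesimally-zonal polynomials Poisson-commute** (polynomial form of `bracket_eq_zero_of_coaxial_zonal`). [folklore] -/
theorem detP_eq_zero_of_coaxial {n : Fin 3 → ℝ} (hn : n ≠ 0) {A B : MvPolynomial (Fin 3) ℝ}
    (hA : Zonal.detP (C (n 0) * X 0 + C (n 1) * X 1 + C (n 2) * X 2) A = 0)
    (hB : Zonal.detP (C (n 0) * X 0 + C (n 1) * X 1 + C (n 2) * X 2) B = 0) : Zonal.detP A B = 0 := by
  have hne : (WithLp.toLp 2 n : E3) ≠ 0 := by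
    intro h
    apply hn
    funext i
    have := congrArg (fun v : E3 => v i) h
    simpa using this
  have hgA : Continuous (gradient (Zonal.evalE A)) :=
    (OrderTwo.contDiff_gradient (n := 0) ((Zonal.contDiff_evalE A).of_le (by norm_cast))).continuous
  have hgB : Continuous (gradient (Zonal.evalE B)) :=
    (OrderTwo.contDiff_gradient (n := 0) ((Zonal.contDiff_evalE B).of_le (by norm_cast))).continuous
  apply Zonal.eq_zero_of_evalE_eq_zero
  intro y
  rw [← LoopLaw.loopBracket_evalE]
  exact bracket_eq_zero_of_coaxial_zonal hne hgA hgB ((Zonal.detP_lin_eq_zero_iff n A).mp hA)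
    ((Zonal.detP_lin_eq_zero_iff n B).mp hB) y

/-- ★★ **ZONAL-TOP DESCENT, polynomial level.**  If the top shell `P_D` (`D = max K`, `P_D ≠ 0`) of a finite tower passing order one
is annihilated by the rotation derivative about the real axis `n ≠ 0`, so is every shell. [folklore] -/
theorem finiteTower_detP_lin_eq_zero_of_top (hK : ∀ l ∈ K, 1 ≤ l) (hH : ∀ l ∈ K, ContDiff ℝ (⊤ : ℕ∞) (H l))
    (hhom : ∀ l ∈ K, ∀ (c : ℝ) (y : E3), H l (c • y) = c ^ l * H l y)
    (hharm : ∀ l ∈ K, ∀ y, Laplacian.laplacian (H l) y = 0)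
    (hL1 : ∀ x : E3, x ≠ 0 → horizonL1 (fun z => ∑ l ∈ K, horizonProfile l (H l) 0 z) 0 x = 0)
    (P : ℕ → MvPolynomial (Fin 3) ℝ)
    (hP : ∀ l ∈ K, (P l).IsHomogeneous l ∧ Zonal.lapP (P l) = 0 ∧ ∀ y, H l y = Zonal.evalE (P l) y)
    {D : ℕ} (hD : D ∈ K) (hmax : ∀ l ∈ K, l ≤ D) (hPD : P D ≠ 0) {n : Fin 3 → ℝ} (hn : n ≠ 0)
    (htop : Zonal.detP (C (n 0) * X 0 + C (n 1) * X 1 + C (n 2) * X 2) (P D) = 0) :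
    ∀ l ∈ K, Zonal.detP (C (n 0) * X 0 + C (n 1) * X 1 + C (n 2) * X 2) (P l) = 0 := by
  classical
  by_contra hcon
  push Not at hcon
  set S : Finset ℕ := K.filter fun l => Zonal.detP (C (n 0) * X 0 + C (n 1) * X 1 + C (n 2) * X 2) (P l) ≠ 0 with hS
  have hSne : S.Nonempty := by
    obtain ⟨l, hl, hbad⟩ := hcon
    exact ⟨l, Finset.mem_filter.mpr ⟨hl, hbad⟩⟩
  set j₀ : ℕ := S.max' hSne with hj₀
  have hj₀S : j₀ ∈ S := Finset.max'_mem S hSne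
  obtain ⟨hj₀K, hj₀bad⟩ := Finset.mem_filter.mp hj₀S
  have hj₀D : j₀ ≠ D := fun h => hj₀bad (by rw [h]; exact htop)
  have hgood : ∀ l ∈ K, j₀ < l → Zonal.detP (C (n 0) * X 0 + C (n 1) * X 1 + C (n 2) * X 2) (P l) = 0 := by
    intro l hl hlt
    by_contra h
    exact (Finset.le_max' S l (Finset.mem_filter.mpr ⟨hl, h⟩)).not_gt hlt
  -- the pair `(j₀, D)` is isolated
  have hiso := finiteTower_chartT_detP_eq_zero K H hK hH hhom hharm hL1 P (fun l hl => (hP l hl).2.2) hj₀K hD hj₀D (by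
    intro j hj k hk hjk hsum h1 h2
    have hjD := hmax j hj
    have hkD := hmax k hk
    rcases eq_or_ne k D with rfl | hkne
    · -- `(j, D)` with `j > j₀`
      have hjgt : j₀ < j := lt_of_le_of_ne (by omega) (fun h => h1 ⟨h.symm, rfl⟩)
      exact detP_eq_zero_of_coaxial hn (hgood j hj hjgt) htop
    · rcases eq_or_ne j D with rfl | hjne
      · have hkgt : j₀ < k := lt_of_le_of_ne (by omega) (fun h => h2 ⟨rfl, h.symm⟩)
        exact detP_eq_zero_of_coaxial hn htop (hgood k hk hkgt)
      · have hjlt : j < D := lt_of_le_of_ne hjD hjne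
        have hklt : k < D := lt_of_le_of_ne hkD hkne
        exact detP_eq_zero_of_coaxial hn (hgood j hj (by omega)) (hgood k hk (by omega)))
  -- complexify
  set a : Fin 3 → ℂ := fun i => ((n i : ℝ) : ℂ) with ha'
  have ha : a ≠ 0 := ofReal_axis_ne_zero hn
  have hlin : map (algebraMap ℝ ℂ) (C (n 0) * X 0 + C (n 1) * X 1 + C (n 2) * X 2 : MvPolynomial (Fin 3) ℝ)
      = C (a 0) * X 0 + C (a 1) * X 1 + C (a 2) * X 2 := map_lin n
  have hrotD : Zonal.detP (C (a 0) * X 0 + C (a 1) * X 1 + C (a 2) * X 2) (map (algebraMap ℝ ℂ) (P D)) = 0 := by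
    rw [← hlin, ← Zonal.map_detP, htop, map_zero]
  set f : ℂ[X] := Zonal.chartT (map (algebraMap ℝ ℂ) (P j₀)) with hf
  set g : ℂ[X] := Zonal.chartT (map (algebraMap ℝ ℂ) (P D)) with hg
  set q : ℂ[X] := Zonal.chartT (C (a 0) * X 0 + C (a 1) * X 1 + C (a 2) * X 2) with hq
  have hq0 : q ≠ 0 := fun h => ha (Zonal.lin_eq_zero_of_chartT_eq_zero h)
  obtain ⟨β, hβ⟩ := Zonal.exists_chartT_eq_C_mul_pow_of_detP_lin_eq_zero (((hP D hD).1).map (algebraMap ℝ ℂ)) (hK D hD)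
    ha hrotD
  -- the weighted Wronskian law for the pair and its consequences
  have hW := Zonal.chartT_detP (((hP j₀ hj₀K).1).map (algebraMap ℝ ℂ)) (((hP D hD).1).map (algebraMap ℝ ℂ))
  rw [← Zonal.map_detP, hiso, mul_zero] at hW
  have hWr := Zonal.wronskian_pow_pow_eq_zero (hK j₀ hj₀K) (hK D hD) (sub_eq_zero.mp hW.symm)
  have hg0 : g ≠ 0 := fun h => hPD (Zonal.eq_zero_of_chartT_map_eq_zero (hP D hD).1 (hP D hD).2.1 h)
  obtain ⟨c, hc⟩ := Zonal.exists_C_mul_of_wronskian_eq_zero (pow_ne_zero _ hg0) hWr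
  -- `f^D = c · g^{j₀} = (c β^{j₀}) · (q^{j₀})^D`
  have hfD : f ^ D = Polynomial.C (c * β ^ j₀) * (q ^ j₀) ^ D := by
    rw [hc]
    change Polynomial.C c * g ^ j₀ = _
    rw [show g = Polynomial.C β * q ^ D from hβ, mul_pow, ← Polynomial.C_pow, ← mul_assoc, ← Polynomial.C_mul, ← pow_mul,
      ← pow_mul, mul_comm D j₀]
  obtain ⟨γ, hγ⟩ := Zonal.exists_eq_C_mul_pow_of_pow_eq (hK D hD) hq0 hfD
  have hzon := Zonal.detP_lin_eq_zero_of_chartT_eq (((hP j₀ hj₀K).1).map (algebraMap ℝ ℂ)) (hK j₀ hj₀K)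
    (by rw [← Zonal.map_lapP, (hP j₀ hj₀K).2.1, map_zero]) a hγ
  rw [← hlin, ← Zonal.map_detP, map_eq_zero_iff _ (map_injective (algebraMap ℝ ℂ) (RCLike.ofReal_injective))] at hzon
  exact hj₀bad hzon

/-- ★★ **COPRIME TOP PAIR ⇒ ZONAL TOP SHELL, polynomial level.**  If the two largest degrees `D′ < D` of a finite tower passing order one
are coprime and `P_D, P_{D′} ≠ 0`, the top shell is annihilated by the rotation derivative about some real axis. [folklore] -/
theorem finiteTower_exists_axis_of_coprime (hK : ∀ l ∈ K, 1 ≤ l) (hH : ∀ l ∈ K, ContDiff ℝ (⊤ : ℕ∞) (H l))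
    (hhom : ∀ l ∈ K, ∀ (c : ℝ) (y : E3), H l (c • y) = c ^ l * H l y)
    (hharm : ∀ l ∈ K, ∀ y, Laplacian.laplacian (H l) y = 0)
    (hL1 : ∀ x : E3, x ≠ 0 → horizonL1 (fun z => ∑ l ∈ K, horizonProfile l (H l) 0 z) 0 x = 0)
    (P : ℕ → MvPolynomial (Fin 3) ℝ)
    (hP : ∀ l ∈ K, (P l).IsHomogeneous l ∧ Zonal.lapP (P l) = 0 ∧ ∀ y, H l y = Zonal.evalE (P l) y)
    {D D' : ℕ} (hD : D ∈ K) (hD' : D' ∈ K) (hlt : D' < D) (hmax : ∀ l ∈ K, l ≤ D) (hsec : ∀ l ∈ K, l ≠ D → l ≤ D')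
    (hcop : Nat.Coprime D' D) (hPD : P D ≠ 0) (hPD' : P D' ≠ 0) :
    ∃ n : Fin 3 → ℝ, n ≠ 0 ∧ Zonal.detP (C (n 0) * X 0 + C (n 1) * X 1 + C (n 2) * X 2) (P D) = 0 := by
  set f : ℂ[X] := Zonal.chartT (map (algebraMap ℝ ℂ) (P D')) with hf
  set g : ℂ[X] := Zonal.chartT (map (algebraMap ℝ ℂ) (P D)) with hg
  have hW := finiteTower_top_wronskian K H hK hH hhom hharm hL1 P (fun l hl => ⟨(hP l hl).1, (hP l hl).2.2⟩) hD hD' hlt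
    hmax hsec
  have hWr := Zonal.wronskian_pow_pow_eq_zero (hK D' hD') (hK D hD) hW
  have hg0 : g ≠ 0 := fun h => hPD (Zonal.eq_zero_of_chartT_map_eq_zero (hP D hD).1 (hP D hD).2.1 h)
  have hf0 : f ≠ 0 := fun h => hPD' (Zonal.eq_zero_of_chartT_map_eq_zero (hP D' hD').1 (hP D' hD').2.1 h)
  obtain ⟨c, hc⟩ := Zonal.exists_C_mul_of_wronskian_eq_zero (pow_ne_zero _ hg0) hWr
  obtain ⟨q, hqm, hgq, hdeg⟩ := Zonal.exists_monic_eq_C_mul_pow_of_coprime hcop.symm (hK D hD) hf0 hc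
  -- `deg q ≤ 2`: `q` is the chart of a linear form
  have hq2 : q.natDegree ≤ 2 := by
    have h1 : g.natDegree ≤ 2 * D := Zonal.natDegree_chartT_le (((hP D hD).1).map (algebraMap ℝ ℂ))
    have h2 : D * q.natDegree ≤ D * 2 := by rw [hdeg, mul_comm]; exact h1
    exact Nat.le_of_mul_le_mul_left h2 (hK D hD)
  obtain ⟨a, ha⟩ := Zonal.exists_lin_chartT_eq hq2
  have ha0 : a ≠ 0 := by
    rintro rfl
    have : q = 0 := by rw [← ha]; simp
    exact hqm.ne_zero this
  have hchart : g = Polynomial.C g.leadingCoeff * Zonal.chartT (C (a 0) * X 0 + C (a 1) * X 1 + C (a 2) * X 2) ^ D := by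
    rw [ha]; exact hgq
  have hrot := Zonal.detP_lin_eq_zero_of_chartT_eq (((hP D hD).1).map (algebraMap ℝ ℂ)) (hK D hD)
    (by rw [← Zonal.map_lapP, (hP D hD).2.1, map_zero]) a hchart
  exact Zonal.exists_real_axis_of_detP_lin_eq_zero ha0 hrot

/-! ### ★★ The theorems -/

/-- ★★ **THM A — ZONAL-TOP DESCENT.**  A finite scale-free tower of horizon profiles of smooth homogeneous harmonic shells
(degrees `≥ 1`, any number of shells, zero shells allowed) annihilated by the order-one horizon law off the centre, whose TOP shell
`H_D` (`D = max K`, `H_D ≢ 0`) is infinitesimally zonal about `a ≠ 0`, is COAXIALLY ZONAL about `a`: every shell satisfies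
`⟪a × y, ∇H_l(y)⟫ = 0`. [folklore] -/
theorem finiteTower_zonal_of_zonalTop (hK : ∀ l ∈ K, 1 ≤ l) (hH : ∀ l ∈ K, ContDiff ℝ (⊤ : ℕ∞) (H l))
    (hhom : ∀ l ∈ K, ∀ (c : ℝ) (y : E3), H l (c • y) = c ^ l * H l y)
    (hharm : ∀ l ∈ K, ∀ y, Laplacian.laplacian (H l) y = 0)
    (hL1 : ∀ x : E3, x ≠ 0 → horizonL1 (fun z => ∑ l ∈ K, horizonProfile l (H l) 0 z) 0 x = 0)
    {D : ℕ} (hD : D ∈ K) (hmax : ∀ l ∈ K, l ≤ D) (hD0 : ∃ y, H D y ≠ 0)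
    {a : E3} (ha : a ≠ 0) (htop : ∀ y : E3, ⟪cross a y, gradient (H D) y⟫ = 0) :
    ∀ l ∈ K, ∀ y : E3, ⟪cross a y, gradient (H l) y⟫ = 0 := by
  obtain ⟨P, hP⟩ := finiteTower_exists_polys K H hH hhom hharm
  set n : Fin 3 → ℝ := fun i => a i with hn'
  have han : (WithLp.toLp 2 n : E3) = a := by ext i; simp [hn']
  have hn : n ≠ 0 := by
    intro h
    apply ha
    rw [← han, h]
    rfl
  have hPD : P D ≠ 0 := by
    obtain ⟨y, hy⟩ := hD0
    intro h
    apply hy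
    rw [(hP D hD).2.2 y, h]
    simp [Zonal.evalE]
  have htop' : Zonal.detP (C (n 0) * X 0 + C (n 1) * X 1 + C (n 2) * X 2) (P D) = 0 := by
    rw [Zonal.detP_lin_eq_zero_iff]
    intro y
    rw [han, ← show H D = Zonal.evalE (P D) from funext (hP D hD).2.2]
    exact htop y
  intro l hl y
  have h := finiteTower_detP_lin_eq_zero_of_top K H hK hH hhom hharm hL1 P hP hD hmax hPD hn htop' l hl
  rw [Zonal.detP_lin_eq_zero_iff] at h
  have := h y
  rwa [han, ← show H l = Zonal.evalE (P l) from funext (hP l hl).2.2] at this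

/-- ★★ **THM B — COPRIME TOP PAIR.**  A finite scale-free tower of horizon profiles of smooth homogeneous harmonic shells (degrees
`≥ 1`) annihilated by the order-one horizon law off the centre, whose two largest degrees `D′ < D` are COPRIME with `H_D, H_{D′} ≢ 0`,
is COAXIALLY ZONAL: there is one axis `a ≠ 0` with `⟪a × y, ∇H_l(y)⟫ = 0` for every shell. [folklore] -/
theorem finiteTower_zonal_of_coprime (hK : ∀ l ∈ K, 1 ≤ l) (hH : ∀ l ∈ K, ContDiff ℝ (⊤ : ℕ∞) (H l))
    (hhom : ∀ l ∈ K, ∀ (c : ℝ) (y : E3), H l (c • y) = c ^ l * H l y)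
    (hharm : ∀ l ∈ K, ∀ y, Laplacian.laplacian (H l) y = 0)
    (hL1 : ∀ x : E3, x ≠ 0 → horizonL1 (fun z => ∑ l ∈ K, horizonProfile l (H l) 0 z) 0 x = 0)
    {D D' : ℕ} (hD : D ∈ K) (hD' : D' ∈ K) (hlt : D' < D) (hmax : ∀ l ∈ K, l ≤ D) (hsec : ∀ l ∈ K, l ≠ D → l ≤ D')
    (hcop : Nat.Coprime D' D) (hD0 : ∃ y, H D y ≠ 0) (hD'0 : ∃ y, H D' y ≠ 0) :
    ∃ a : E3, a ≠ 0 ∧ ∀ l ∈ K, ∀ y : E3, ⟪cross a y, gradient (H l) y⟫ = 0 := by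
  obtain ⟨P, hP⟩ := finiteTower_exists_polys K H hH hhom hharm
  have hne : ∀ {l}, l ∈ K → (∃ y, H l y ≠ 0) → P l ≠ 0 := by
    intro l hl ⟨y, hy⟩ h
    apply hy
    rw [(hP l hl).2.2 y, h]
    simp [Zonal.evalE]
  obtain ⟨n, hn, htop⟩ := finiteTower_exists_axis_of_coprime K H hK hH hhom hharm hL1 P hP hD hD' hlt hmax hsec hcop
    (hne hD hD0) (hne hD' hD'0)
  have hna : (WithLp.toLp 2 n : E3) ≠ 0 := by
    intro h
    apply hn
    funext i
    have := congrArg (fun v : E3 => v i) h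
    simpa using this
  refine ⟨WithLp.toLp 2 n, hna, fun l hl y => ?_⟩
  have h := finiteTower_detP_lin_eq_zero_of_top K H hK hH hhom hharm hL1 P hP hD hmax (hne hD hD0) hn htop l hl
  rw [Zonal.detP_lin_eq_zero_iff] at h
  have := h y
  rwa [← show H l = Zonal.evalE (P l) from funext (hP l hl).2.2] at this

/-- THM A with the ZONAL FUNCTIONAL FORM of the Defs twin as conclusion: `H_l(y) = ‖y‖^l g_l(⟪a,y⟫/‖y‖)` off the origin. [folklore] -/
theorem finiteTower_zonalForm_of_zonalTop (hK : ∀ l ∈ K, 1 ≤ l) (hH : ∀ l ∈ K, ContDiff ℝ (⊤ : ℕ∞) (H l))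
    (hhom : ∀ l ∈ K, ∀ (c : ℝ) (y : E3), H l (c • y) = c ^ l * H l y)
    (hharm : ∀ l ∈ K, ∀ y, Laplacian.laplacian (H l) y = 0)
    (hL1 : ∀ x : E3, x ≠ 0 → horizonL1 (fun z => ∑ l ∈ K, horizonProfile l (H l) 0 z) 0 x = 0)
    {D : ℕ} (hD : D ∈ K) (hmax : ∀ l ∈ K, l ≤ D) (hD0 : ∃ y, H D y ≠ 0)
    {a : E3} (ha : a ≠ 0) (htop : ∀ y : E3, ⟪cross a y, gradient (H D) y⟫ = 0) :
    ∀ l ∈ K, ∃ g : ℝ → ℝ, ∀ y : E3, y ≠ 0 → H l y = ‖y‖ ^ l * g (⟪a, y⟫ / ‖y‖) := by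
  intro l hl
  have hrot := finiteTower_zonal_of_zonalTop K H hK hH hhom hharm hL1 hD hmax hD0 ha htop l hl
  exact exists_zonalForm_of_inner_cross_gradient_eq_zero (l := l) ha ((hH l hl).differentiable (by simp))
    (fun c y _ => hhom l hl c y) hrot

/-- THM B with the ZONAL FUNCTIONAL FORM of the Defs twin as conclusion. [folklore] -/
theorem finiteTower_zonalForm_of_coprime (hK : ∀ l ∈ K, 1 ≤ l) (hH : ∀ l ∈ K, ContDiff ℝ (⊤ : ℕ∞) (H l))
    (hhom : ∀ l ∈ K, ∀ (c : ℝ) (y : E3), H l (c • y) = c ^ l * H l y)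
    (hharm : ∀ l ∈ K, ∀ y, Laplacian.laplacian (H l) y = 0)
    (hL1 : ∀ x : E3, x ≠ 0 → horizonL1 (fun z => ∑ l ∈ K, horizonProfile l (H l) 0 z) 0 x = 0)
    {D D' : ℕ} (hD : D ∈ K) (hD' : D' ∈ K) (hlt : D' < D) (hmax : ∀ l ∈ K, l ≤ D) (hsec : ∀ l ∈ K, l ≠ D → l ≤ D')
    (hcop : Nat.Coprime D' D) (hD0 : ∃ y, H D y ≠ 0) (hD'0 : ∃ y, H D' y ≠ 0) :
    ∃ a : E3, a ≠ 0 ∧ ∀ l ∈ K, ∃ g : ℝ → ℝ, ∀ y : E3, y ≠ 0 → H l y = ‖y‖ ^ l * g (⟪a, y⟫ / ‖y‖) := by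
  obtain ⟨a, ha, hrot⟩ := finiteTower_zonal_of_coprime K H hK hH hhom hharm hL1 hD hD' hlt hmax hsec hcop hD0 hD'0
  exact ⟨a, ha, fun l hl => exists_zonalForm_of_inner_cross_gradient_eq_zero (l := l) ha
    ((hH l hl).differentiable (by simp)) (fun c y _ => hhom l hl c y) (hrot l hl)⟩

end FiniteTowerZonality

end Summit.NavierStokesRegularity.NavierStokesRegularity.Theorems.PoloidalLiouville.HorizonTower

end
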